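import Summits.AtomisticToContinuum.Crystallization.Theorems.FrustratedLawDichotomyStrainedPatchHomEntryLeafHTA2QCellG70V1

/-!
# v3 ANCHOR CELL (T0) `cG70 × wG70` (0.70 t_b, FULL 2⁻⁹ entry cube (k₆ = 6)), part 2: the p-dependent kernel facts `restG70V` (≈ 80 s) and `linG70V` (sharp linear pieces)
# (27623 `(H) HomFloor (1/625)`, hcp half; pre-staged by hand-1 g37, LANDED by hand-1 g38 on critic GO row 1436 (E) / 1437 (E) «T0 anchors»)

Kernel facts; 0 sorry; standard axioms.  `--supports stmt-AtomisticToContinuum-27623`.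
-/

namespace Summit.AtomisticToContinuum.Crystallization.Theorems.FrustratedLawDichotomyStrainedPatchHomEntryLeafHT

open Literature.Analysis.ValidatedNumerics.Numerics
open Summit.AtomisticToContinuum.Crystallization.Theorems.FrustratedLawDichotomyStrainedPatchHomCertTree (CertTree treeOK)
open Summit.AtomisticToContinuum.Crystallization.Theorems.FrustratedLawDichotomyStrainedPatchHomEntryTable (muRec)
open Summit.AtomisticToContinuum.Crystallization.Theorems.FrustratedLawDichotomyStrainedPatchHomEntryFitHcpCentred (entryLeafOKHQDCRS)
open Summit.AtomisticToContinuum.Crystallization.Theorems.FrustratedLawDichotomyStrainedPatchHomSlopeLJ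
open Summit.AtomisticToContinuum.Crystallization.Theorems.FrustratedLawDichotomyStrainedPatchHomSlopeLJAffine
open Summit.AtomisticToContinuum.Crystallization.Theorems.FrustratedLawDichotomyStrainedPatchHomSlopeLJAffine2Kit
open Summit.AtomisticToContinuum.Crystallization.Theorems.FrustratedLawDichotomyStrainedPatchHomSlopeLJAffine2KitS (rem3LJS)

set_option maxRecDepth 100000 in
set_option maxHeartbeats 4000000 in
/-- ★ KERNEL: the non-slope conjuncts of the certificate side for `pG70V`. -/
theorem restG70V : htCertRestA2 pG70V JG70 cG70 wG70 = true := by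
  decide +kernel

set_option maxRecDepth 100000 in
set_option maxHeartbeats 4000000 in
/-- ★ KERNEL: `g₀ + lin + ⌈√ΣQ²⌉ + rem3♯ + nai = 880159805233 ≤ GnG70V` (sharp third-order remainder `rem3LJS`). -/
theorem linG70V : g0LJ cG70 (htScA2F cG70 wG70 JG70 (htNearU cG70 wG70)) + linLJA cG70 wG70 JG70 (htScA2F cG70 wG70 JG70 (htNearU cG70 wG70)) + sqrtQ QG70 +
    rem3LJS cG70 wG70 JG70 (htScA2F cG70 wG70 JG70 (htNearU cG70 wG70)) + naiSLJ cG70 (hullW JG70 wG70) (htSnA2F cG70 wG70 JG70 (htNearU cG70 wG70)) ≤ GnG70V := by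
  decide +kernel

end Summit.AtomisticToContinuum.Crystallization.Theorems.FrustratedLawDichotomyStrainedPatchHomEntryLeafHT
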